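import Mathlib
import Summits.Ventures.PercRepro2.TypedSpineSt
import Summits.Ventures.PercRepro2.CaseOneCubic

/-!
# The case-1 rung reduced to the fully reduced typed graphs (blind cell PercRepro2, p2 g0,
2026-08-25; sub-claim S1 for sub-claim S5; the lead's rulings INBOX 2026-08-25T01:18:38Z (1) and
01:33:49Z (1))

p1's `CaseOneCubic.lean` writes the cleared case-1 inequality (ii) as the cubic form of the
four-term kernel `KII` and states the typed (ii) as `TypedII` (every typed three-copy sum of `KII`
with the free edges pinned is nonnegative). Here:

* **`KII_eq_KIIst`** — `KII` factors through the 7-coordinate state: `KII x y z = KIIst (st x)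
  (st y) (st z)` with the explicit state kernel `KIIst` (the eight indicators of the four terms
  through the state, `iA_eq_st` … `iPDoU_eq_st`), i.e. `KII = stKer … KIIst`;
* **`ruleKernel_KIIst`** — `KIIst` satisfies the two inputs of the reduction calculus: it vanishes
  when a copy has `a₁ ↔ a₂` (every factor is an event within `Q`), and it decomposes for the
  pendant rules (every term carries exactly ONE `b`-factor, in the first copy, and exactly ONE
  `o`-factor, in the first or the second copy — so the kill identities are finite Boolean checks);
* **`typedCount_KII_nonneg_of_reduced`** and **`typedII_of_reduced`** — THE TRANSPORT: if the typed
  counts of `KII` are nonnegative on every FULLY REDUCED typed graph (`TypedRed.Reduced`: no typed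
  loop / root pair / parallel pair, no unmarked vertex of typed degree one or two, neither `b` nor
  `o` of typed degree one) at the all-closed pinning, then they are nonnegative on every instance
  and `TypedII` holds — hence (ii) and (RV) for every admissible weight vector (p1's
  `zSplitII_of_pinned` / `rv_of_pinned`). The remaining content of the case-1 rung is therefore
  (ii) on `Reduced` typed graphs — whose all-marked members are the K₅ certificate / the star
  injection (sub-claim S5), and whose members with unmarked vertices (every unmarked vertex of
  typed degree ≥ 3) are its open core.

Own code; standard axioms.
-/

namespace Summit.Ventures.PercRepro2

open UnionCluster

namespace CaseOne

open CovForm CovForm.OneTyped CovForm.TypedRed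

/-! ## The four-term kernel on states -/

section StateKernel

/-- `1_A = 1[a₃ ∈ C₁] 1_Q` on states. -/
def aS (s : St) : ℤ := if s.L3 && !s.q' then 1 else 0
/-- `1_QB = 1[b ∈ C₂] 1_Q` on states. -/
def qbS (s : St) : ℤ := if s.Hb && !s.q' then 1 else 0
/-- `1_AB = 1[b ∈ C₂] 1[a₃ ∈ C₁] 1_Q` on states. -/
def abS (s : St) : ℤ := if s.Hb && s.L3 && !s.q' then 1 else 0
/-- `1_AO = 1[a₃ ∈ C₁] 1[o ∈ C₂] 1_Q` on states. -/
def aoS (s : St) : ℤ := if s.L3 && s.Ho && !s.q' then 1 else 0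
/-- `1_ABO = 1[b ∈ C₂] 1[a₃ ∈ C₁] 1[o ∈ C₂] 1_Q` on states. -/
def aboS (s : St) : ℤ := if s.Hb && s.L3 && s.Ho && !s.q' then 1 else 0
/-- `1_PD = 1[a₃ ∉ U] 1_Q` on states. -/
def pdS (s : St) : ℤ := if !s.L3 && !s.H3 && !s.q' then 1 else 0
/-- `1_PDoU = 1[o ∈ U] 1[a₃ ∉ U] 1_Q` on states. -/
def pdouS (s : St) : ℤ := if (s.Lo || s.Ho) && !s.L3 && !s.H3 && !s.q' then 1 else 0

/-- **The case-1 kernel on states**: the four terms of the cleared (ii). -/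
def KIIst (x y z : St) : ℤ :=
  aboS x * (qB y * pdS z) + qbS x * (pdouS y * aS z) - qbS x * (aoS y * pdS z) -
    abS x * (pdouS y * qB z)

/-- The term whose `o`-factor sits in the first copy. -/
def KIIoX (x y z : St) : ℤ := aboS x * (qB y * pdS z)
/-- The terms whose `o`-factor sits in the second copy. -/
def KIIoY (x y z : St) : ℤ :=
  qbS x * (pdouS y * aS z) - qbS x * (aoS y * pdS z) - abS x * (pdouS y * qB z)

/-- `KIIst = KIIoX + KIIoY`. -/
lemma KIIst_eq_oX_add_oY (x y z : St) : KIIst x y z = KIIoX x y z + KIIoY x y z := by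
  unfold KIIst KIIoX KIIoY; ring

/-- **`KIIst` vanishes when a copy fails `Q`.** -/
theorem KIIst_eq_zero_of_q' (x y z : St) (h : x.q' = true ∨ y.q' = true ∨ z.q' = true) :
    KIIst x y z = 0 := by
  rcases h with h | h | h <;> simp [KIIst, aboS, qbS, abS, aS, aoS, pdS, pdouS, qB, h]

/-- **The pendant-`b` identity on states**: every `b`-factor sits in the first copy. -/
theorem KIIst_killB (p q r : Bool) (x y z : St) :
    KIIst (cond p x (killB x)) (cond q y (killB y)) (cond r z (killB z)) =
      (if p then KIIst x y z else 0) + (if q then (0 : ℤ) else 0) + (if r then (0 : ℤ) else 0) := by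
  cases p <;> cases q <;> cases r <;>
    simp [KIIst, aboS, qbS, abS, aS, aoS, pdS, pdouS, qB, killB_q', killB_Lo, killB_Ho,
      killB_Hb, killB_L3, killB_H3]

/-- **The pendant-`o` identity on states**: the `o`-factor sits in the first copy (term 1) or the
second (terms 2–4). -/
theorem KIIst_killO (p q r : Bool) (x y z : St) :
    KIIst (cond p x (killO x)) (cond q y (killO y)) (cond r z (killO z)) =
      (if p then KIIoX x y z else 0) + (if q then KIIoY x y z else 0) + (if r then (0 : ℤ) else 0) := by
  cases p <;> cases q <;> cases r <;>
    simp [KIIst, KIIoX, KIIoY, aboS, qbS, abS, aS, aoS, pdS, pdouS, qB, killO_q', killO_Lo,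
      killO_Ho, killO_Hb, killO_L3, killO_H3] <;> ring

end StateKernel

/-! ## `KII` through the state -/

section Bridge

open Classical

variable {V : Type*} {E : Type*} {R : Type*} [Field R]
variable (ends : E → Sym2 V) (o a₁ a₂ a₃ b : V)

/-- `1_Q` through the state. -/
lemma iQ_eq_st' (ω : Config E) :
    CaseOne.iQ (R := R) ends a₁ a₂ ω = ((qB (st ends o a₁ a₂ a₃ b ω) : ℤ) : R) := by
  unfold CaseOne.iQ qB st St.q'
  have e1 : Conn ends ω a₁ a₂ ↔ Conn ends ω a₂ a₁ := ⟨conn_symm, conn_symm⟩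
  simp only [Set.indicator_apply, Set.mem_compl_iff, mem_connEvent, Pi.one_apply, e1]
  by_cases h : Conn ends ω a₂ a₁ <;> simp [h]

/-- `1_A` through the state. -/
lemma iA_eq_st (ω : Config E) :
    CaseOne.iA (R := R) ends a₁ a₂ a₃ ω = ((aS (st ends o a₁ a₂ a₃ b ω) : ℤ) : R) := by
  unfold CaseOne.iA aS st St.q' St.L3
  have e1 : Conn ends ω a₁ a₂ ↔ Conn ends ω a₂ a₁ := ⟨conn_symm, conn_symm⟩
  simp only [Set.indicator_apply, Set.mem_inter_iff, Set.mem_compl_iff, mem_connEvent,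
    Pi.one_apply, e1]
  by_cases h1 : Conn ends ω a₂ a₁ <;> by_cases h2 : Conn ends ω a₁ a₃ <;> simp [h1, h2]

/-- `1_QB` through the state. -/
lemma iQB_eq_st (ω : Config E) :
    CaseOne.iQB (R := R) ends a₁ a₂ b ω = ((qbS (st ends o a₁ a₂ a₃ b ω) : ℤ) : R) := by
  unfold CaseOne.iQB qbS st St.q' St.Hb
  have e1 : Conn ends ω a₁ a₂ ↔ Conn ends ω a₂ a₁ := ⟨conn_symm, conn_symm⟩
  simp only [Set.indicator_apply, Set.mem_inter_iff, Set.mem_compl_iff, mem_connEvent,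
    Pi.one_apply, e1]
  by_cases h1 : Conn ends ω a₂ a₁ <;> by_cases h2 : Conn ends ω a₂ b <;> simp [h1, h2]

/-- `1_AB` through the state. -/
lemma iAB_eq_st (ω : Config E) :
    CaseOne.iAB (R := R) ends a₁ a₂ a₃ b ω = ((abS (st ends o a₁ a₂ a₃ b ω) : ℤ) : R) := by
  unfold CaseOne.iAB abS st St.q' St.Hb St.L3
  have e1 : Conn ends ω a₁ a₂ ↔ Conn ends ω a₂ a₁ := ⟨conn_symm, conn_symm⟩
  simp only [Set.indicator_apply, Set.mem_inter_iff, Set.mem_compl_iff, mem_connEvent,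
    Pi.one_apply, e1]
  by_cases h1 : Conn ends ω a₂ a₁ <;> by_cases h2 : Conn ends ω a₂ b <;>
    by_cases h3 : Conn ends ω a₁ a₃ <;> simp [h1, h2, h3]

/-- `1_AO` through the state. -/
lemma iAO_eq_st (ω : Config E) :
    CaseOne.iAO (R := R) ends o a₁ a₂ a₃ ω = ((aoS (st ends o a₁ a₂ a₃ b ω) : ℤ) : R) := by
  unfold CaseOne.iAO aoS st St.q' St.L3 St.Ho
  have e1 : Conn ends ω a₁ a₂ ↔ Conn ends ω a₂ a₁ := ⟨conn_symm, conn_symm⟩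
  simp only [Set.indicator_apply, Set.mem_inter_iff, Set.mem_compl_iff, mem_connEvent,
    Pi.one_apply, e1]
  by_cases h1 : Conn ends ω a₂ a₁ <;> by_cases h2 : Conn ends ω a₁ a₃ <;>
    by_cases h3 : Conn ends ω a₂ o <;> simp [h1, h2, h3]

/-- `1_ABO` through the state. -/
lemma iABO_eq_st (ω : Config E) :
    CaseOne.iABO (R := R) ends o a₁ a₂ a₃ b ω = ((aboS (st ends o a₁ a₂ a₃ b ω) : ℤ) : R) := by
  unfold CaseOne.iABO aboS st St.q' St.Hb St.L3 St.Ho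
  have e1 : Conn ends ω a₁ a₂ ↔ Conn ends ω a₂ a₁ := ⟨conn_symm, conn_symm⟩
  simp only [Set.indicator_apply, Set.mem_inter_iff, Set.mem_compl_iff, mem_connEvent,
    Pi.one_apply, e1]
  by_cases h1 : Conn ends ω a₂ a₁ <;> by_cases h2 : Conn ends ω a₂ b <;>
    by_cases h3 : Conn ends ω a₁ a₃ <;> by_cases h4 : Conn ends ω a₂ o <;> simp [h1, h2, h3, h4]

/-- `1_PD` through the state. -/
lemma iPDc_eq_st (ω : Config E) :
    CaseOne.iPDc (R := R) ends a₁ a₂ a₃ ω = ((pdS (st ends o a₁ a₂ a₃ b ω) : ℤ) : R) := by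
  unfold CaseOne.iPDc pdS st St.q' St.L3 St.H3
  have e1 : Conn ends ω a₁ a₂ ↔ Conn ends ω a₂ a₁ := ⟨conn_symm, conn_symm⟩
  simp only [Set.indicator_apply, Set.mem_inter_iff, Set.mem_compl_iff, mem_connEvent,
    Pi.one_apply, e1]
  by_cases h1 : Conn ends ω a₂ a₁ <;> by_cases h2 : Conn ends ω a₁ a₃ <;>
    by_cases h3 : Conn ends ω a₂ a₃ <;> simp [h1, h2, h3]

/-- `1_PDoU` through the state. -/
lemma iPDoU_eq_st (ω : Config E) :
    CaseOne.iPDoU (R := R) ends o a₁ a₂ a₃ ω = ((pdouS (st ends o a₁ a₂ a₃ b ω) : ℤ) : R) := by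
  unfold CaseOne.iPDoU pdouS st St.q' St.Lo St.Ho St.L3 St.H3
  have e1 : Conn ends ω a₁ a₂ ↔ Conn ends ω a₂ a₁ := ⟨conn_symm, conn_symm⟩
  simp only [Set.indicator_apply, Set.mem_inter_iff, Set.mem_compl_iff, Set.mem_union,
    mem_connEvent, Pi.one_apply, e1]
  by_cases h1 : Conn ends ω a₂ a₁ <;> by_cases h2 : Conn ends ω a₁ o <;>
    by_cases h3 : Conn ends ω a₂ o <;> by_cases h4 : Conn ends ω a₁ a₃ <;>
    by_cases h5 : Conn ends ω a₂ a₃ <;> simp [h1, h2, h3, h4, h5]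

/-- **`KII` on states.** -/
theorem KII_eq_KIIst (x y z : Config E) :
    KII (R := R) ends o a₁ a₂ a₃ b x y z =
      ((KIIst (st ends o a₁ a₂ a₃ b x) (st ends o a₁ a₂ a₃ b y) (st ends o a₁ a₂ a₃ b z) : ℤ) : R) := by
  unfold KII sepKernel
  simp only [Fin.sum_univ_succ, Fin.sum_univ_zero, Matrix.cons_val_zero, Matrix.cons_val_succ,
    add_zero]
  simp only [iABO_eq_st ends o a₁ a₂ a₃ b, iQ_eq_st' ends o a₁ a₂ a₃ b, iPDc_eq_st ends o a₁ a₂ a₃ b,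
    iQB_eq_st ends o a₁ a₂ a₃ b, iPDoU_eq_st ends o a₁ a₂ a₃ b, iA_eq_st ends o a₁ a₂ a₃ b,
    iAO_eq_st ends o a₁ a₂ a₃ b, iAB_eq_st ends o a₁ a₂ a₃ b]
  unfold KIIst
  push_cast
  ring

/-- **`KII` is the state kernel of `KIIst`.** -/
theorem KII_eq_stKer :
    (KII ends o a₁ a₂ a₃ b : Config E → Config E → Config E → R) =
      stKer ends o a₁ a₂ a₃ b (fun x y z => ((KIIst x y z : ℤ) : R)) := by
  funext x y z
  exact KII_eq_KIIst ends o a₁ a₂ a₃ b x y z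

end Bridge

/-! ## The calculus applies to `KII` -/

section Rule

variable {R : Type*} [Field R]

/-- **`KIIst` satisfies the inputs of the reduction calculus.** -/
theorem ruleKernel_KIIst : RuleKernel (fun x y z : St => ((KIIst x y z : ℤ) : R)) where
  root_pair := fun x y z h => by rw [KIIst_eq_zero_of_q' x y z h]; simp
  pendant_b := ⟨fun x y z => ((KIIst x y z : ℤ) : R), fun _ _ _ => 0, fun _ _ _ => 0,
    fun x y z => by ring,
    fun p q r x y z => by
      rw [KIIst_killB]
      cases p <;> cases q <;> cases r <;> simp⟩
  pendant_o := ⟨fun x y z => ((KIIoX x y z : ℤ) : R), fun x y z => ((KIIoY x y z : ℤ) : R),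
    fun _ _ _ => 0,
    fun x y z => by rw [KIIst_eq_oX_add_oY]; push_cast; ring,
    fun p q r x y z => by
      rw [KIIst_killO]
      cases p <;> cases q <;> cases r <;> simp⟩

end Rule

/-! ## The transport -/

section Transport

variable {V : Type*} {E : Type*} [DecidableEq V] [Fintype E] [DecidableEq E] {R : Type*} [Field R]
  [LinearOrder R] [IsStrictOrderedRing R]

/-- **The typed counts of `KII` on every instance from the fully reduced typed graphs** (the
state-kernel spine `typedCount_nonneg_of_reduced_st` applied to `KIIst`). -/
theorem typedCount_KII_nonneg_of_reduced
    (hNR : ∀ (ends : E → Sym2 V) (o a₁ a₂ a₃ b : V) (F : Finset E) (τ : E → ℕ),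
      (∀ e ∈ F, τ e = 1 ∨ τ e = 2) → Reduced ends o a₁ a₂ a₃ b F →
        0 ≤ typedCount F (fun _ => false) τ
          (KII ends o a₁ a₂ a₃ b : Config E → Config E → Config E → R))
    (ends : E → Sym2 V) (o a₁ a₂ a₃ b : V) (F : Finset E) (z : Config E) (τ : E → ℕ)
    (hτ : ∀ e ∈ F, τ e = 1 ∨ τ e = 2) :
    0 ≤ typedCount F z τ (KII ends o a₁ a₂ a₃ b : Config E → Config E → Config E → R) := by
  rw [KII_eq_stKer]
  refine typedCount_nonneg_of_reduced_st _ ruleKernel_KIIst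
    (fun ends o a₁ a₂ a₃ b F τ hτ hred => ?_) ends o a₁ a₂ a₃ b F z τ hτ
  rw [← KII_eq_stKer]
  exact hNR ends o a₁ a₂ a₃ b F τ hτ hred

/-- **THE TRANSPORT FOR THE CASE-1 RUNG**: (ii) on the fully reduced typed graphs gives the typed
(ii) (`TypedII`), hence (ii) and (RV) for every admissible weight vector (`zSplitII_of_pinned`,
`rv_of_pinned`). -/
theorem typedII_of_reduced
    (hNR : ∀ (ends : E → Sym2 V) (o a₁ a₂ a₃ b : V) (F : Finset E) (τ : E → ℕ),
      (∀ e ∈ F, τ e = 1 ∨ τ e = 2) → Reduced ends o a₁ a₂ a₃ b F →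
        0 ≤ typedCount F (fun _ => false) τ
          (KII ends o a₁ a₂ a₃ b : Config E → Config E → Config E → R))
    (ends : E → Sym2 V) (o a₁ a₂ a₃ b : V) : TypedII (R := R) ends o a₁ a₂ a₃ b := by
  intro q G σ hq _ hσ
  exact triSum_nonneg_of_typedCount (KII ends o a₁ a₂ a₃ b)
    (fun F z τ hτ => typedCount_KII_nonneg_of_reduced hNR ends o a₁ a₂ a₃ b F z τ hτ) q hq G σ hσ

/-- **(ii) for every admissible weight vector from (ii) on the fully reduced typed graphs.** -/
theorem zSplitII_of_reduced
    (hNR : ∀ (ends : E → Sym2 V) (o a₁ a₂ a₃ b : V) (F : Finset E) (τ : E → ℕ),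
      (∀ e ∈ F, τ e = 1 ∨ τ e = 2) → Reduced ends o a₁ a₂ a₃ b F →
        0 ≤ typedCount F (fun _ => false) τ
          (KII ends o a₁ a₂ a₃ b : Config E → Config E → Config E → R))
    (ends : E → Sym2 V) (o a₁ a₂ a₃ b : V) (p : E → R) (hp : IsProbVec p) :
    ZSplitII p ends o a₁ a₂ a₃ b :=
  zSplitII_of_pinned ends o a₁ a₂ a₃ b (typedII_of_reduced hNR ends o a₁ a₂ a₃ b) p hp

end Transport

end CaseOne

end Summit.Ventures.PercRepro2
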